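import Summits.AnomalousDissipation.AnomalousDissipation.Theorems.MomentLadder.Negative.Clauses
import Literature.Analysis.FunctionSpaces.TorusEnstrophyTrilinear
import Literature.Analysis.FunctionSpaces.TorusTruncationH1
import Literature.Analysis.FluidPDE.ZerothLaw

/-!
# The Stokes-weighted truncation row: stub StokesTruncRow of line `Sketch`
# (crux `MomentParity.MomentLadder`, stmt-AnomalousDissipation-11463)

Stub A2b. For a level-`N` field `u ∈ H` write `W := P_N u` (a smooth divergence-free trigonometric
polynomial with `u = W` a.e. on `T³`). The Navier–Stokes generator paired with the test field
`w := -ΔW` (the Stokes operator applied to the truncation) reads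
`⟨F(u), -ΔW⟩ = (f, -ΔW) - ν ‖ΔW‖₂² + ∫ ⟪(W·∇)W, ΔW⟫`:
the viscous term is `ν ∫ ⟪u, Δ(-ΔW)⟫ = -ν ∫ ⟪W, Δ²W⟫ = -ν ∫ ‖ΔW‖²` (Green's identity twice), and the
inertial term is `∫ ⟪D(-ΔW) u, u⟫ = -∫ ⟪(W·∇)ΔW, W⟫ = ∫ ⟪(W·∇)W, ΔW⟫` (antisymmetry of the trilinear
form on the divergence-free `W`). The general identity for any smooth divergence-free `W` agreeing a.e.
with `u` is `nsGeneratorPairing_neg_laplacian_of_ae_eq`; the stub specialises it to `W = P_N u`.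
-/

set_option linter.dupNamespace false

noncomputable section

namespace Summit.AnomalousDissipation.AnomalousDissipation.Theorems.MomentLadder

open MeasureTheory Filter Topology Set
open scoped ENNReal NNReal InnerProductSpace RealInnerProductSpace Polynomial
open Literature.Analysis.FunctionSpaces Literature.Analysis.FluidPDE
open Summit.AnomalousDissipation.AnomalousDissipation.Theses.MomentParity
open Summit.AnomalousDissipation.AnomalousDissipation.Theorems.QuarticGate.Negative
open Summit.AnomalousDissipation.AnomalousDissipation.Theorems.MomentLadder.Negative

/-- **The generator against `-ΔW` for a smooth solenoidal a.e.-representative.** If `W` is smooth and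
divergence free with `W = u` a.e. on `T³`, then
`⟨F(u), -ΔW⟩ = (f, -ΔW) - ν ∫ ‖ΔW‖² + ∫ ⟪(W·∇)W, ΔW⟫`
(Green's identity `∫ ⟪W, Δ²W⟫ = ∫ ‖ΔW‖²` and antisymmetry `∫ ⟪(W·∇)ΔW, W⟫ = -∫ ⟪ΔW, (W·∇)W⟫`). -/
theorem nsGeneratorPairing_neg_laplacian_of_ae_eq (ν : ℝ)
    (f : UnitAddTorus (Fin 3) → EuclideanSpace ℝ (Fin 3)) (u : Torus.energySpace (Fin 3))
    {W : UnitAddTorus (Fin 3) → EuclideanSpace ℝ (Fin 3)} (hW : Torus.IsSmooth W)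
    (hdiv : Torus.IsDivFree W)
    (hae : ∀ᵐ x ∂volume, W x = (u.1 : UnitAddTorus (Fin 3) → EuclideanSpace ℝ (Fin 3)) x) :
    Torus.nsGeneratorPairing ν f u (fun x => -(Torus.laplacian W x)) =
      (∫ x, ⟪f x, -(Torus.laplacian W x)⟫_ℝ) - ν * (∫ x, ‖Torus.laplacian W x‖ ^ 2) +
        ∫ x, ⟪Torus.convect W W x, Torus.laplacian W x⟫_ℝ := by
  have hL : Torus.IsSmooth (Torus.laplacian W) := hW.laplacian
  -- `-ΔW = (-1) • ΔW`, so `Δ(-ΔW) = -Δ²W` and `D(-ΔW) = -D(ΔW)`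
  have hneg : (fun y => -(Torus.laplacian W y)) = (-1 : ℝ) • Torus.laplacian W :=
    funext fun y => (neg_one_smul ℝ _).symm
  have hlap : ∀ x, Torus.laplacian (fun y => -(Torus.laplacian W y)) x =
      -(Torus.laplacian (Torus.laplacian W) x) := by
    intro x
    rw [hneg, Torus.laplacian_const_smul_apply hL (-1) x, neg_one_smul]
  have hfd : ∀ x a, Torus.fderiv (fun y => -(Torus.laplacian W y)) x a =
      -(Torus.fderiv (Torus.laplacian W) x a) := by
    intro x a
    rw [hneg, Torus.fderiv_const_smul (hL.isContDiff (by simp)) (-1) x, smul_apply, neg_one_smul]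
  -- the viscous term: `∫ ⟪u, Δ(-ΔW)⟫ = -∫ ‖ΔW‖²`
  have h2 : ∫ x, ⟪(u.1 : UnitAddTorus (Fin 3) → EuclideanSpace ℝ (Fin 3)) x,
      Torus.laplacian (fun y => -(Torus.laplacian W y)) x⟫_ℝ = -∫ x, ‖Torus.laplacian W x‖ ^ 2 := by
    simp_rw [hlap, inner_neg_right, integral_neg]
    rw [neg_inj]
    calc ∫ x, ⟪(u.1 : UnitAddTorus (Fin 3) → EuclideanSpace ℝ (Fin 3)) x,
          Torus.laplacian (Torus.laplacian W) x⟫_ℝ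
        = ∫ x, ⟪W x, Torus.laplacian (Torus.laplacian W) x⟫_ℝ :=
          integral_congr_ae (by filter_upwards [hae] with x hx; rw [hx])
      _ = ∫ x, ⟪Torus.laplacian W x, Torus.laplacian W x⟫_ℝ :=
          (Torus.integral_inner_laplacian_comm hW hL).symm
      _ = ∫ x, ‖Torus.laplacian W x‖ ^ 2 :=
          integral_congr_ae (ae_of_all _ fun x => real_inner_self_eq_norm_sq _)
  -- the inertial term: `∫ ⟪D(-ΔW) u, u⟫ = -∫ ⟪(W·∇)ΔW, W⟫ = ∫ ⟪(W·∇)W, ΔW⟫`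
  have h3 : ∫ x, ⟪Torus.fderiv (fun y => -(Torus.laplacian W y)) x
        ((u.1 : UnitAddTorus (Fin 3) → EuclideanSpace ℝ (Fin 3)) x),
      (u.1 : UnitAddTorus (Fin 3) → EuclideanSpace ℝ (Fin 3)) x⟫_ℝ =
      ∫ x, ⟪Torus.convect W W x, Torus.laplacian W x⟫_ℝ := by
    calc ∫ x, ⟪Torus.fderiv (fun y => -(Torus.laplacian W y)) x
            ((u.1 : UnitAddTorus (Fin 3) → EuclideanSpace ℝ (Fin 3)) x),
          (u.1 : UnitAddTorus (Fin 3) → EuclideanSpace ℝ (Fin 3)) x⟫_ℝ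
        = ∫ x, ⟪Torus.fderiv (fun y => -(Torus.laplacian W y)) x (W x), W x⟫_ℝ :=
          integral_congr_ae (by filter_upwards [hae] with x hx; rw [hx])
      _ = -∫ x, ⟪Torus.convect W (Torus.laplacian W) x, W x⟫_ℝ := by
          rw [← integral_neg]
          refine integral_congr_ae (ae_of_all _ fun x => ?_)
          simp only [hfd, inner_neg_left, Torus.convect]
      _ = ∫ x, ⟪Torus.laplacian W x, Torus.convect W W x⟫_ℝ := by
          rw [Torus.integral_inner_convect_eq_neg hW hdiv hL hW, neg_neg]
      _ = ∫ x, ⟪Torus.convect W W x, Torus.laplacian W x⟫_ℝ :=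
          integral_congr_ae (ae_of_all _ fun x => real_inner_comm _ _)
  rw [Torus.nsGeneratorPairing, Torus.inertialPairing, h2, h3]
  ring

/-- STUB A2b. **The Stokes-weighted truncation row on level-`N` fields**: for `u ∈ H` carried by
the level-`N` Galerkin space, with `W := P_N u`,
`⟨F(u), -ΔP_N u⟩ = (f, -ΔP_N u) - ν ‖ΔP_N u‖₂² + ∫ ⟪(P_N u·∇)P_N u, ΔP_N u⟫`
(`P_N u` is smooth and divergence free, and `P_N u = u` a.e. on `T³` for level-`N` fields). -/
theorem stub_stokesTruncRow :
    ∀ (ν : ℝ) (f : UnitAddTorus (Fin 3) → EuclideanSpace ℝ (Fin 3)) (N : ℕ) (u : Torus.energySpace (Fin 3)),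
      IsLevel N u →
      Torus.nsGeneratorPairing ν f u (fun x => -(Torus.laplacian (Torus.fourierTruncate N
          (u.1 : UnitAddTorus (Fin 3) → EuclideanSpace ℝ (Fin 3))) x)) =
        (∫ x, ⟪f x, -(Torus.laplacian (Torus.fourierTruncate N
            (u.1 : UnitAddTorus (Fin 3) → EuclideanSpace ℝ (Fin 3))) x)⟫_ℝ) -
          ν * (∫ x, ‖Torus.laplacian (Torus.fourierTruncate N
            (u.1 : UnitAddTorus (Fin 3) → EuclideanSpace ℝ (Fin 3))) x‖ ^ 2) +
          ∫ x, ⟪Torus.convect (Torus.fourierTruncate N (u.1 : UnitAddTorus (Fin 3) → EuclideanSpace ℝ (Fin 3)))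
              (Torus.fourierTruncate N (u.1 : UnitAddTorus (Fin 3) → EuclideanSpace ℝ (Fin 3))) x,
            Torus.laplacian (Torus.fourierTruncate N
              (u.1 : UnitAddTorus (Fin 3) → EuclideanSpace ℝ (Fin 3))) x⟫_ℝ := by
  intro ν f N u hu
  have hae : ∀ᵐ x ∂volume, Torus.fourierTruncate N (u.1 : UnitAddTorus (Fin 3) → EuclideanSpace ℝ (Fin 3)) x =
      (u.1 : UnitAddTorus (Fin 3) → EuclideanSpace ℝ (Fin 3)) x := by
    filter_upwards [CubicParityLoud.Negative.fourierTruncate_ae_eq_of_isLevel hu] with x hx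
    exact hx
  exact nsGeneratorPairing_neg_laplacian_of_ae_eq ν f u (Torus.isSmooth_fourierTruncate N _)
    (Torus.isDivFree_fourierTruncate (Lp.memLp u.1) (Torus.isWeaklyDivFree_of_mem_energySpace u.2) N) hae

end Summit.AnomalousDissipation.AnomalousDissipation.Theorems.MomentLadder

end
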